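import Summits.Ventures.YMGap.Thresholds.RegionBoundaryTilt
import Literature.Probability.LatticeModels.SharpnessProofs
import HarnessLib

/-!
# Venture YMGap — BOUNDARY INSENSITIVITY OF THE DLR KERNELS by exponential tilting, II:
# the one-link tilt (OBJECT U, piece U3, file 2 of 3)

HONEST FRAMING: venture file (cell `pub-ymgap`, track (a), seat p2). WHAT THIS IS: if two exterior
configurations `η, η'` agree off ONE link `b`, the tilt `W_b = regionPot E η' β - regionPot E η β` of the
kernel potentials is, on `SU(N)^E`, `Nβ · ∑_{p ∋ b, p ∩ E ≠ ∅} (Re tr U_p(· ∨ η') - Re tr U_p(· ∨ η))`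
(`tilt_emb_eq`); hence `sup |W_b| ≤ w₀ := N|β| · 2N · 2(d-1)` (`abs_tilt_le_of_eq_off`: at most `2(d-1)`
plaquettes contain `b`, each term `≤ 2N`), and `e^{W_b}` is per-link Lipschitz on `SU(N)^E` with data
`e^{w₀} · 2N^{3/2}|β| · #{p ∩ E ≠ ∅ : b, e ∈ p}` at the link `e` (`linkLipschitz_exp_tilt`: the plaquette
action is affine in each link, `Re tr U_p = Re tr(a · staple)`), supported on links within sup-distance `1`
of `b` (`supNorm_sub_le_one_of_common_plaquette`) and of total size `≤ e^{w₀} · 2N^{3/2}|β| · 8(d-1)`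
(`sum_card_filter_common_plaquette_le`). WHAT IT IS NOT: no covariance bound, no uniqueness statement.

## References

* H. Shen, R. Zhu, X. Zhu, CMP 400 (2023) 805–851, §4.1 (the plaquette action is affine in each link).
* H.-O. Georgii, Gibbs Measures and Phase Transitions, 2nd ed. (2011), Ch. 8.
-/

noncomputable section

open scoped Matrix ComplexConjugate BigOperators Matrix.Norms.Frobenius ContDiff Topology ProbabilityTheory
open Matrix Complex Finset MeasureTheory Filter ProbabilityTheory
open Literature.MathematicalPhysics.QuantumFieldTheory
open Literature.MathematicalPhysics.QuantumLattice (fundamentalRep continuous_fundamentalRep fundamentalRep_apply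
  fundamentalRep_mem_unitaryGroup LGConfig ZdPlaquette plaquettesTouching plaquetteEdges mem_plaquettesTouching_iff
  plaquetteObs isCylinder_plaquetteObs abs_plaquetteObs_le_holds wilsonBoundaryAction ymSpecification
  isProbabilityMeasure_ymSpecification)
open Literature.Probability.LatticeModels (glueWith glueWith_apply_mem glueWith_apply_not_mem measurable_glueWith Site.supNorm
  Site.supNorm_le_iff Site.supNorm_add_le Site.norm_eq_supNorm)
open Literature.MathematicalPhysics.QuantumFieldTheory.SUNBakryEmery (SUN)

namespace Summit.Ventures.YMGap

namespace LatticeBakryEmery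

variable {d N : ℕ}

/-! ### The tilt through the plaquette observables of glued configurations -/

/-- On `SU(N)^E` the kernel potential is an affine function of the boundary Wilson action of the
glued configuration: `regionPot E η β (U_E) = N²β·#P - Nβ·S_E(U_E ∨ η)`. -/
theorem regionPot_emb_eq (E : Finset (Literature.MathematicalPhysics.QuantumFieldTheory.ZdEdge d))
    (η : LGConfig d (SUN N)) (β : ℝ) (ζ : PSU ↥E N) :
    regionPot E η β (emb ζ) = (N : ℝ) * β * N * (plaquettesTouching E).card -
      (N : ℝ) * β * wilsonBoundaryAction (fundamentalRep (Fin N)) E (glueWith E ζ η) := by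
  have h := neg_mul_wilsonBoundaryAction_glueWith E η β ζ
  linarith

/-- **The tilt as a sum of plaquette differences**: on `SU(N)^E`,
`regionPot E η' β - regionPot E η β = Nβ · ∑_{p ∩ E ≠ ∅} (Re tr U_p(U_E ∨ η') - Re tr U_p(U_E ∨ η))`. -/
theorem tilt_emb_eq (E : Finset (Literature.MathematicalPhysics.QuantumFieldTheory.ZdEdge d))
    (η η' : LGConfig d (SUN N)) (β : ℝ) (ζ : PSU ↥E N) :
    regionPot E η' β (emb ζ) - regionPot E η β (emb ζ) =
      (N : ℝ) * β * ∑ p ∈ plaquettesTouching E,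
        (plaquetteObs (fundamentalRep (Fin N)) p.1 p.2.1.1 p.2.1.2 (glueWith E ζ η') -
          plaquetteObs (fundamentalRep (Fin N)) p.1 p.2.1.1 p.2.1.2 (glueWith E ζ η)) := by
  rw [regionPot_emb_eq, regionPot_emb_eq]
  simp only [wilsonBoundaryAction, Finset.sum_sub_distrib, Finset.sum_const, nsmul_eq_mul]
  ring

/-- Gluing the same interior into two exteriors that agree off the link `b` gives configurations
that agree off `b`. -/
theorem glueWith_congr_off (E : Finset (Literature.MathematicalPhysics.QuantumFieldTheory.ZdEdge d))
    {η η' : LGConfig d (SUN N)} {b : Literature.MathematicalPhysics.QuantumFieldTheory.ZdEdge d}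
    (hb : ∀ e, e ≠ b → η' e = η e) (ζ : PSU ↥E N)
    (x : Literature.MathematicalPhysics.QuantumFieldTheory.ZdEdge d) (hx : x ≠ b) :
    glueWith E ζ η' x = glueWith E ζ η x := by
  by_cases hxE : x ∈ E
  · rw [glueWith_apply_mem E ζ η' hxE, glueWith_apply_mem E ζ η hxE]
  · rw [glueWith_apply_not_mem E ζ η' hxE, glueWith_apply_not_mem E ζ η hxE, hb x hx]

/-- Gluing two interiors that differ only at the link `e` into the same exterior: the second glued
configuration is the first one updated at `e`. -/
theorem glueWith_eq_update (E : Finset (Literature.MathematicalPhysics.QuantumFieldTheory.ZdEdge d))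
    (η : LGConfig d (SUN N)) {g h : PSU ↥E N} {e : ↥E} (hgh : ∀ e', e' ≠ e → g e' = h e') :
    glueWith E h η = Function.update (glueWith E g η) (e : Literature.MathematicalPhysics.QuantumFieldTheory.ZdEdge d) (h e) := by
  funext x
  by_cases hx : x = (e : Literature.MathematicalPhysics.QuantumFieldTheory.ZdEdge d)
  · subst hx
    rw [Function.update_self, glueWith_apply_mem E h η e.2]
  · rw [Function.update_of_ne hx]
    by_cases hxE : x ∈ E
    · rw [glueWith_apply_mem E h η hxE, glueWith_apply_mem E g η hxE]
      have hne : (⟨x, hxE⟩ : ↥E) ≠ e := fun h' => hx (congrArg Subtype.val h')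
      rw [hgh _ hne]
    · rw [glueWith_apply_not_mem E h η hxE, glueWith_apply_not_mem E g η hxE]

/-- A plaquette not containing `b` has the same observable on configurations agreeing off `b`. -/
theorem plaquetteObs_congr_off {U V : LGConfig d (SUN N)} {b : Literature.MathematicalPhysics.QuantumFieldTheory.ZdEdge d}
    (hUV : ∀ x, x ≠ b → U x = V x) {p : ZdPlaquette d} (hb : b ∉ plaquetteEdges p) :
    plaquetteObs (fundamentalRep (Fin N)) p.1 p.2.1.1 p.2.1.2 U =
      plaquetteObs (fundamentalRep (Fin N)) p.1 p.2.1.1 p.2.1.2 V :=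
  isCylinder_plaquetteObs (fundamentalRep (Fin N)) p fun x hx =>
    hUV x fun hxb => hb (hxb ▸ Finset.mem_coe.1 hx)

/-- `|Re tr U_p| ≤ N` for `SU(N)` configurations. -/
theorem abs_plaquetteObs_le_N (p : ZdPlaquette d) (U : LGConfig d (SUN N)) :
    |plaquetteObs (fundamentalRep (Fin N)) p.1 p.2.1.1 p.2.1.2 U| ≤ N :=
  abs_plaquetteObs_le_holds (fundamentalRep (Fin N)) fundamentalRep_mem_unitaryGroup p.1 _ _ U

/-- **One-link Lipschitz bound for a plaquette observable**: replacing the variable at a link `x`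
of `p` changes `Re tr U_p` by at most `√N ‖a - a'‖_F` (the plaquette action is affine in each link:
`Re tr U_p = Re tr(a · staple)`, and the staple is unitary). -/
theorem abs_plaquetteObs_update_sub_le {p : ZdPlaquette d} {x : Literature.MathematicalPhysics.QuantumFieldTheory.ZdEdge d}
    (hx : x ∈ plaquetteEdges p) (U : LGConfig d (SUN N)) (a a' : SUN N) :
    |plaquetteObs (fundamentalRep (Fin N)) p.1 p.2.1.1 p.2.1.2 (Function.update U x a) -
        plaquetteObs (fundamentalRep (Fin N)) p.1 p.2.1.1 p.2.1.2 (Function.update U x a')| ≤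
      Real.sqrt N * suFrobDist a a' := by
  classical
  unfold plaquetteObs
  rw [re_trace_holonomy_update (fundamentalRep (Fin N)) fundamentalRep_mem_unitaryGroup hx U a,
    re_trace_holonomy_update (fundamentalRep (Fin N)) fundamentalRep_mem_unitaryGroup hx U a',
    fundamentalRep_apply, fundamentalRep_apply, fundamentalRep_apply]
  refine (abs_re_trace_su_mul_sub_le a a' _).trans ?_
  rw [frobNorm_su, mul_comm]

/-! ### One-link change of the exterior: sup bound and Lipschitz data of the tilt -/

/-- **Sup bound of the one-link tilt**: if `η, η'` agree off the link `b`, then on `SU(N)^E`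
`|regionPot E η' β - regionPot E η β| ≤ N|β| · 2N · 2(d-1) = 4(d-1)N²|β|` (only the `≤ 2(d-1)`
plaquettes through `b` contribute, each by `≤ 2N`). -/
theorem abs_tilt_le_of_eq_off (E : Finset (Literature.MathematicalPhysics.QuantumFieldTheory.ZdEdge d))
    {η η' : LGConfig d (SUN N)} (β : ℝ) {b : Literature.MathematicalPhysics.QuantumFieldTheory.ZdEdge d}
    (hb : ∀ e, e ≠ b → η' e = η e) (ζ : PSU ↥E N) :
    |regionPot E η' β (emb ζ) - regionPot E η β (emb ζ)| ≤ (N : ℝ) * |β| * (2 * N) * (2 * (d - 1) : ℕ) := by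
  classical
  rw [tilt_emb_eq, abs_mul, abs_mul, Nat.abs_cast]
  set P := plaquettesTouching E with hP
  set Pb := P.filter fun p => b ∈ plaquetteEdges p with hPb
  set D : ZdPlaquette d → ℝ := fun p =>
    plaquetteObs (fundamentalRep (Fin N)) p.1 p.2.1.1 p.2.1.2 (glueWith E ζ η') -
      plaquetteObs (fundamentalRep (Fin N)) p.1 p.2.1.1 p.2.1.2 (glueWith E ζ η) with hD
  have hzero : ∀ p ∈ P, p ∉ Pb → D p = 0 := by
    intro p hp hpb
    have hbp : b ∉ plaquetteEdges p := fun h => hpb (Finset.mem_filter.2 ⟨hp, h⟩)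
    simp only [hD]
    rw [plaquetteObs_congr_off (glueWith_congr_off E hb ζ) hbp, sub_self]
  have hsum : ∑ p ∈ P, D p = ∑ p ∈ Pb, D p :=
    (Finset.sum_subset (Finset.filter_subset _ P) fun p hp hpb => hzero p hp hpb).symm
  have hcard : Pb.card ≤ 2 * (d - 1) := by
    refine le_trans (Finset.card_le_card fun p hp => ?_) (card_plaquettesTouching_singleton_le b)
    exact mem_plaquettesTouching_singleton.2 (Finset.mem_filter.1 hp).2
  have hterm : ∀ p, |D p| ≤ 2 * N := fun p => by
    simp only [hD]
    refine (abs_sub _ _).trans ?_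
    have h1 := abs_plaquetteObs_le_N p (glueWith E ζ η')
    have h2 := abs_plaquetteObs_le_N p (glueWith E ζ η)
    linarith
  have hs : |∑ p ∈ P, D p| ≤ (2 * N) * (2 * (d - 1) : ℕ) := by
    rw [hsum]
    calc |∑ p ∈ Pb, D p| ≤ ∑ p ∈ Pb, |D p| := Finset.abs_sum_le_sum_abs _ _
      _ ≤ ∑ _p ∈ Pb, (2 * (N : ℝ)) := Finset.sum_le_sum fun p _ => hterm p
      _ = Pb.card * (2 * N) := by rw [Finset.sum_const, nsmul_eq_mul]
      _ ≤ (2 * (d - 1) : ℕ) * (2 * N) := by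
          refine mul_le_mul_of_nonneg_right ?_ (by positivity)
          exact_mod_cast hcard
      _ = (2 * N) * (2 * (d - 1) : ℕ) := mul_comm _ _
  calc (N : ℝ) * |β| * |∑ p ∈ P, D p| ≤ (N : ℝ) * |β| * ((2 * N) * (2 * (d - 1) : ℕ)) :=
        mul_le_mul_of_nonneg_left hs (by positivity)
    _ = (N : ℝ) * |β| * (2 * N) * (2 * (d - 1) : ℕ) := by ring

/-- **Per-link Lipschitz data of the one-link tilt** `e^{W_b}`, `W_b = regionPot E η' β - regionPot E η β`
for `η, η'` agreeing off `b`: the link `e ∈ E` carries the constant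
`e^{w₀} · (N|β| · 2√N) · #{p ∩ E ≠ ∅ : b ∈ p ∧ e ∈ p}`, `w₀ = 4(d-1)N²|β|` — zero unless `e` and `b`
lie on a common plaquette. -/
theorem linkLipschitz_exp_tilt (E : Finset (Literature.MathematicalPhysics.QuantumFieldTheory.ZdEdge d))
    {η η' : LGConfig d (SUN N)} (β : ℝ) {b : Literature.MathematicalPhysics.QuantumFieldTheory.ZdEdge d}
    (hb : ∀ e, e ≠ b → η' e = η e) :
    LinkLipschitz (fun Q : Cfg ↥E N => Real.exp (regionPot E η' β Q - regionPot E η β Q))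
      fun e : ↥E => Real.exp ((N : ℝ) * |β| * (2 * N) * (2 * (d - 1) : ℕ)) * ((N : ℝ) * |β| * (2 * Real.sqrt N)) *
        ((plaquettesTouching E).filter fun p =>
          b ∈ plaquetteEdges p ∧ (e : Literature.MathematicalPhysics.QuantumFieldTheory.ZdEdge d) ∈ plaquetteEdges p).card := by
  classical
  intro e g h hgh
  set w₀ : ℝ := (N : ℝ) * |β| * (2 * N) * (2 * (d - 1) : ℕ) with hw₀
  set P := plaquettesTouching E with hP
  set Pbe := P.filter fun p =>
    b ∈ plaquetteEdges p ∧ (e : Literature.MathematicalPhysics.QuantumFieldTheory.ZdEdge d) ∈ plaquetteEdges p with hPbe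
  -- Step 1: `exp` is `e^{w₀}`-Lipschitz on the range of the tilt
  have hWg := abs_tilt_le_of_eq_off E β hb g
  have hWh := abs_tilt_le_of_eq_off E β hb h
  have hexp : |Real.exp (regionPot E η' β (emb g) - regionPot E η β (emb g)) -
      Real.exp (regionPot E η' β (emb h) - regionPot E η β (emb h))| ≤
      Real.exp w₀ * |(regionPot E η' β (emb g) - regionPot E η β (emb g)) -
        (regionPot E η' β (emb h) - regionPot E η β (emb h))| :=
    abs_exp_sub_exp_le_of_le (abs_le.1 hWg).2 (abs_le.1 hWh).2
  -- Step 2: the tilt difference as a sum over the plaquettes through `b` AND `e`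
  set D : PSU ↥E N → ZdPlaquette d → ℝ := fun ζ p =>
    plaquetteObs (fundamentalRep (Fin N)) p.1 p.2.1.1 p.2.1.2 (glueWith E ζ η') -
      plaquetteObs (fundamentalRep (Fin N)) p.1 p.2.1.1 p.2.1.2 (glueWith E ζ η) with hD
  have hdiff : (regionPot E η' β (emb g) - regionPot E η β (emb g)) -
      (regionPot E η' β (emb h) - regionPot E η β (emb h)) =
      (N : ℝ) * β * ∑ p ∈ P, (D g p - D h p) := by
    rw [tilt_emb_eq, tilt_emb_eq, ← mul_sub, ← Finset.sum_sub_distrib]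
  have hzero : ∀ p ∈ P, p ∉ Pbe → D g p - D h p = 0 := by
    intro p hp hpbe
    rw [Finset.mem_filter, not_and, not_and_or] at hpbe
    rcases hpbe hp with hbp | hep
    · -- `b ∉ p`: both differences vanish
      simp only [hD]
      rw [plaquetteObs_congr_off (glueWith_congr_off E hb g) hbp,
        plaquetteObs_congr_off (glueWith_congr_off E hb h) hbp, sub_self, sub_self, sub_self]
    · -- `e ∉ p`: the `g`- and `h`-configurations agree on `p`
      have hgh' : ∀ x, x ≠ (e : Literature.MathematicalPhysics.QuantumFieldTheory.ZdEdge d) →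
          glueWith E g η' x = glueWith E h η' x := by
        intro x hx
        rw [glueWith_eq_update E η' hgh, Function.update_of_ne hx]
      have hgh'' : ∀ x, x ≠ (e : Literature.MathematicalPhysics.QuantumFieldTheory.ZdEdge d) →
          glueWith E g η x = glueWith E h η x := by
        intro x hx
        rw [glueWith_eq_update E η hgh, Function.update_of_ne hx]
      simp only [hD]
      rw [plaquetteObs_congr_off hgh' hep, plaquetteObs_congr_off hgh'' hep, sub_self]
  have hsum : ∑ p ∈ P, (D g p - D h p) = ∑ p ∈ Pbe, (D g p - D h p) :=
    (Finset.sum_subset (Finset.filter_subset _ P) fun p hp hpb => hzero p hp hpb).symm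
  -- Step 3: each remaining term is `≤ 2√N ‖g_e - h_e‖_F`
  have hterm : ∀ p ∈ Pbe, |D g p - D h p| ≤ 2 * Real.sqrt N * suFrobDist (g e) (h e) := by
    intro p hp
    have hep : (e : Literature.MathematicalPhysics.QuantumFieldTheory.ZdEdge d) ∈ plaquetteEdges p :=
      (Finset.mem_filter.1 hp).2.2
    have e1 : glueWith E h η' = Function.update (glueWith E g η')
        (e : Literature.MathematicalPhysics.QuantumFieldTheory.ZdEdge d) (h e) := glueWith_eq_update E η' hgh
    have e2 : glueWith E h η = Function.update (glueWith E g η)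
        (e : Literature.MathematicalPhysics.QuantumFieldTheory.ZdEdge d) (h e) := glueWith_eq_update E η hgh
    have e1' : glueWith E g η' = Function.update (glueWith E g η')
        (e : Literature.MathematicalPhysics.QuantumFieldTheory.ZdEdge d) (g e) := by
      rw [← glueWith_apply_mem E g η' e.2, Function.update_eq_self]
    have e2' : glueWith E g η = Function.update (glueWith E g η)
        (e : Literature.MathematicalPhysics.QuantumFieldTheory.ZdEdge d) (g e) := by
      rw [← glueWith_apply_mem E g η e.2, Function.update_eq_self]
    have hA := abs_plaquetteObs_update_sub_le (N := N) hep (glueWith E g η') (g e) (h e)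
    have hB := abs_plaquetteObs_update_sub_le (N := N) hep (glueWith E g η) (g e) (h e)
    rw [← e1, ← e1'] at hA
    rw [← e2, ← e2'] at hB
    simp only [hD]
    rw [show ∀ a b c d' : ℝ, (a - b) - (c - d') = (a - c) - (b - d') from fun a b c d' => by ring]
    refine (abs_sub _ _).trans ?_
    linarith
  -- Step 4: assemble
  have hs : |∑ p ∈ P, (D g p - D h p)| ≤ Pbe.card * (2 * Real.sqrt N * suFrobDist (g e) (h e)) := by
    rw [hsum]
    calc |∑ p ∈ Pbe, (D g p - D h p)| ≤ ∑ p ∈ Pbe, |D g p - D h p| := Finset.abs_sum_le_sum_abs _ _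
      _ ≤ ∑ _p ∈ Pbe, 2 * Real.sqrt N * suFrobDist (g e) (h e) := Finset.sum_le_sum hterm
      _ = Pbe.card * (2 * Real.sqrt N * suFrobDist (g e) (h e)) := by rw [Finset.sum_const, nsmul_eq_mul]
  refine hexp.trans ?_
  rw [hdiff, abs_mul, abs_mul, Nat.abs_cast]
  have hd0 : 0 ≤ suFrobDist (g e) (h e) := suFrobDist_nonneg _ _
  calc Real.exp w₀ * ((N : ℝ) * |β| * |∑ p ∈ P, (D g p - D h p)|)
      ≤ Real.exp w₀ * ((N : ℝ) * |β| * (Pbe.card * (2 * Real.sqrt N * suFrobDist (g e) (h e)))) := by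
        gcongr
    _ = Real.exp w₀ * ((N : ℝ) * |β| * (2 * Real.sqrt N)) * Pbe.card * suFrobDist (g e) (h e) := by ring

/-- The Lipschitz data of the one-link tilt are nonnegative. -/
theorem tiltLipschitzData_nonneg (E : Finset (Literature.MathematicalPhysics.QuantumFieldTheory.ZdEdge d))
    (β : ℝ) (b : Literature.MathematicalPhysics.QuantumFieldTheory.ZdEdge d) (e : ↥E) :
    0 ≤ Real.exp ((N : ℝ) * |β| * (2 * N) * (2 * (d - 1) : ℕ)) * ((N : ℝ) * |β| * (2 * Real.sqrt N)) *
        ((plaquettesTouching E).filter fun p =>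
          b ∈ plaquetteEdges p ∧ (e : Literature.MathematicalPhysics.QuantumFieldTheory.ZdEdge d) ∈ plaquetteEdges p).card := by
  positivity

/-- **The Lipschitz data of the one-link tilt live within sup-distance `1` of `b`**: if a plaquette
contains both `e` and `b`, their base points differ by at most `1` in every coordinate. -/
theorem supNorm_sub_le_one_of_common_plaquette {p : ZdPlaquette d}
    {e b : Literature.MathematicalPhysics.QuantumFieldTheory.ZdEdge d}
    (he : e ∈ plaquetteEdges p) (hb : b ∈ plaquetteEdges p) : Site.supNorm (e.1 - b.1) ≤ 1 := by
  refine Site.supNorm_le_iff.2 fun k => ?_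
  have h1 := apply_sub_eq_zero_or_one_of_mem_plaquetteEdges he k
  have h2 := apply_sub_eq_zero_or_one_of_mem_plaquetteEdges hb k
  have hk : (e.1 - b.1) k = (e.1 k - p.1 k) - (b.1 k - p.1 k) := by simp only [Pi.sub_apply]; ring
  rw [hk]
  rcases h1 with h1 | h1 <;> rcases h2 with h2 | h2 <;> rw [h1, h2] <;> decide

/-- **Total size of the Lipschitz data of the one-link tilt**: at most `4 · 2(d-1)` pairs
`(e, p)` with `e ∈ E ∩ p` and `b ∈ p`. -/
theorem sum_card_filter_common_plaquette_le (E : Finset (Literature.MathematicalPhysics.QuantumFieldTheory.ZdEdge d))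
    (b : Literature.MathematicalPhysics.QuantumFieldTheory.ZdEdge d) :
    ∑ e : ↥E, (((plaquettesTouching E).filter fun p =>
        b ∈ plaquetteEdges p ∧ (e : Literature.MathematicalPhysics.QuantumFieldTheory.ZdEdge d) ∈ plaquetteEdges p).card : ℝ) ≤
      4 * (2 * (d - 1) : ℕ) := by
  classical
  set P := plaquettesTouching E with hP
  set Pb := P.filter fun p => b ∈ plaquetteEdges p with hPb
  have hcardPb : Pb.card ≤ 2 * (d - 1) := by
    refine le_trans (Finset.card_le_card fun p hp => ?_) (card_plaquettesTouching_singleton_le b)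
    exact mem_plaquettesTouching_singleton.2 (Finset.mem_filter.1 hp).2
  -- rewrite each cardinality as a sum of indicators over `Pb`
  have hcard : ∀ e : ↥E, (((plaquettesTouching E).filter fun p =>
      b ∈ plaquetteEdges p ∧ (e : Literature.MathematicalPhysics.QuantumFieldTheory.ZdEdge d) ∈ plaquetteEdges p).card : ℝ) =
      ∑ p ∈ Pb, if (e : Literature.MathematicalPhysics.QuantumFieldTheory.ZdEdge d) ∈ plaquetteEdges p then (1 : ℝ) else 0 := by
    intro e
    rw [Finset.sum_ite, Finset.sum_const_zero, add_zero, Finset.sum_const, nsmul_eq_mul, mul_one, hPb,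
      Finset.filter_filter]
  have hinner : ∀ p : ZdPlaquette d,
      ∑ e : ↥E, (if (e : Literature.MathematicalPhysics.QuantumFieldTheory.ZdEdge d) ∈ plaquetteEdges p then (1 : ℝ) else 0) ≤ 4 := by
    intro p
    rw [Finset.sum_ite, Finset.sum_const_zero, add_zero, Finset.sum_const, nsmul_eq_mul, mul_one]
    have h4 := card_plaquetteEdges_le p
    have hle : (Finset.univ.filter fun e : ↥E =>
        (e : Literature.MathematicalPhysics.QuantumFieldTheory.ZdEdge d) ∈ plaquetteEdges p).card ≤ (plaquetteEdges p).card :=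
      Finset.card_le_card_of_injOn (fun e : ↥E => (e : Literature.MathematicalPhysics.QuantumFieldTheory.ZdEdge d))
        (fun e he => (Finset.mem_filter.1 (Finset.mem_coe.1 he)).2)
        (Set.injOn_of_injective Subtype.val_injective)
    exact_mod_cast hle.trans h4
  calc ∑ e : ↥E, (((plaquettesTouching E).filter fun p =>
          b ∈ plaquetteEdges p ∧ (e : Literature.MathematicalPhysics.QuantumFieldTheory.ZdEdge d) ∈ plaquetteEdges p).card : ℝ)
      = ∑ e : ↥E, ∑ p ∈ Pb, (if (e : Literature.MathematicalPhysics.QuantumFieldTheory.ZdEdge d) ∈ plaquetteEdges p then (1 : ℝ) else 0) :=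
        Finset.sum_congr rfl fun e _ => hcard e
    _ = ∑ p ∈ Pb, ∑ e : ↥E, (if (e : Literature.MathematicalPhysics.QuantumFieldTheory.ZdEdge d) ∈ plaquetteEdges p then (1 : ℝ) else 0) :=
        Finset.sum_comm
    _ ≤ ∑ _p ∈ Pb, (4 : ℝ) := Finset.sum_le_sum fun p _ => hinner p
    _ = Pb.card * 4 := by rw [Finset.sum_const, nsmul_eq_mul]
    _ ≤ (2 * (d - 1) : ℕ) * 4 := by
        refine mul_le_mul_of_nonneg_right ?_ (by norm_num)
        exact_mod_cast hcardPb
    _ = 4 * (2 * (d - 1) : ℕ) := mul_comm _ _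

end LatticeBakryEmery

end Summit.Ventures.YMGap
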